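import Summits.HodgeConjecture.CorCM.DecicWeil23PairCyclicHodgeOfMarkman
import HarnessLib

/-!
# COR-CM — two `(2,3)`-types SHARING ONE EMBEDDING over a decic CM field with DIHEDRAL (more generally: non-cyclic) quintic
# part: the Hodge conjecture for every product of copies of `E, B₁, B₂`, GIVEN ONLY Markman's hyperbolic-sixfold theorem

Cell `pub-hodgecm2` (COR-CM), seat b30 gen 23 (2026-08-22); count-neutral own lane DECIC-2T, part 3 («DECIC-D5»).  Theorems only;
no definition, no named fact, no `sorry`.  HONEST FRAMING: CONDITIONAL on the single displayed named fact
`HodgeTheory.Markman2025_weilClasses_algebraic_hyperbolicSixfold` (E. Markman, arXiv:2502.03415 Thm 1.5.1 — UNREFEREED); `HC_CM`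
is not asserted and no case of the Hodge conjecture is claimed unconditionally.

WHAT IS NEW.  The two-type theorems of gen 22 / DECIC-2T need the realised permutations of the five conjugate pairs to be
`2`-transitive (quintic part `S₅`, `A₅`, `F₂₀`).  If instead some automorphism of `ℂ` ROTATES an enumeration `x` of the five
embeddings over `τ` (`x_l ↦ x_{l+1}`) and another REFLECTS it (`x_l ↦ x_{−l}`) — the realised group contains a dihedral group of
order `10`, which happens for EVERY non-cyclic quintic part `D₅`, `F₂₀`, `A₅`, `S₅` — then for two `(2,3)`-types that SHARE
EXACTLY ONE embedding over `τ` the kernel census `Census/DecicWeil23PairDihedral` (all six dihedral subgroups of `A₅` are clean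
at the meeting normal position) gives the defect law, hence gen 22's sixty `A₅` equations and the whole chain.  (For DISJOINT
types two of the six dihedral positions are genuinely bad — the «mirror» configurations — and no dihedral theorem is stated.)
* §1 `exists_dihedralPerms_subset_realisedPerms`, `modelBalancedD_of_isGaloisBalancedAlg_dihedral`, the frame form
  `…_of_frameD_of_markmanSixfold_dihedral`.
* §2 **`hodgeConjectureFor_biproduct_comp_vec_of_markmanD_dihedral`** — `K ⊇ i(k)` decic, `B₁ ⊨ (K; Φ₁)`, `B₂ ⊨ (K; Φ₂)` CM
  fivefolds of `k`-signature `(2,3)` with `#(Φ₁ ∩ Φ₂ ∩ fibre of τ) = 1` (`hmeet`), `E ⊨ (k; Ψ ∋ τ)`, and a rotated-and-reflected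
  enumeration of the fibre (`hD5`): HC for every `⨁_j ![E, B₁, B₂](κ j)`; `AVDominatedBy` and family forms.
[cite: Markman2025SecantWeil, Thm 1.5.1] [cite: Pohlmann1968, Thm 1] [cite: Shimura1998, §6.1 Thm. 2 Cor. and §18.2 Lemma (i)]
[cite: DixonMortimer1996, §2.1] [cite: MumfordAV1970, §19]

## References
* [Markman2025SecantWeil] E. Markman, arXiv:2502.03415 (unrefereed), Thm 1.5.1.  [Pohlmann1968] H. Pohlmann, Ann. of Math. 88
  (1968), Thm 1.  [Shimura1998] G. Shimura, *Abelian varieties with CM and modular functions*, §6.1 Thm. 2 Cor., §18.2 Lemma (i).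
  [DixonMortimer1996] J. D. Dixon, B. Mortimer, *Permutation Groups*, GTM 163 (1996), §2.1.  [MumfordAV1970] D. Mumford, *Abelian
  Varieties*, §19.
-/

noncomputable section

open CategoryTheory CategoryTheory.Limits NumberField

namespace Summit.HodgeConjecture.CorCM.DecicWeil23Pair

open Literature.AlgebraicGeometry Literature.AlgebraicGeometry.Motives Literature.AlgebraicGeometry.HodgeTheory
open Literature.AlgebraicGeometry.ComplexMultiplication (IsCMTypeRealisation)
open Literature.AlgebraicGeometry.Pohlmann1968
open Literature.AlgebraicTopology.SingularHomology
open Literature.NumberTheory.ComplexMultiplication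
open Summit.HodgeConjecture.CorCM.Census.DecicWeil23Pair (PtD inPos ModelBalancedD ModelBalancedP dihPerm dihedralPerms
  mem_dihedralPerms dihGood exists_dihedral_conj dihPerm_eq_word modelBalancedD_of_modelBalancedP_dihedral)
open Summit.HodgeConjecture.CorCM.OcticCurveFourfold (exists_delta_of_mem)
open Summit.HodgeConjecture.CorCM.Domination (AVDominatedBy)
open Summit.HodgeConjecture.CorCM.AndreRiemann (sumFam avDominatedBy_prod_of_biproduct avDominatedBy_biproduct_reindex)

open scoped Classical

/-! ## §1 Realised dihedral groups and the frame transfer -/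

section Realised

variable {F : Type} [Field F] {e : (F →+* ℂ) ≃ Fin 5 × Bool}

/-- **A realised rotation–reflection pair generates a realised dihedral group**: if `g ρ₀ g⁻¹` and `g r₀ g⁻¹` are realised, one
of the six tabulated groups `D₅(j)` consists of realised permutations. [cite: Shimura1998, §18.2 Lemma (i)] -/
theorem exists_dihedralPerms_subset_realisedPerms {g : Equiv.Perm (Fin 5)}
    (hrot : g * dihPerm 0 1 * g⁻¹ ∈ realisedPerms e) (hrefl : g * dihPerm 0 5 * g⁻¹ ∈ realisedPerms e) :
    ∃ j : Fin 6, ((∃ a : Fin 4, g * dihPerm 0 1 * g⁻¹ = dihPerm j 1 ^ ((a : ℕ) + 1)) ∧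
      ∃ b : Fin 5, g * dihPerm 0 5 * g⁻¹ = dihPerm j (Fin.natAdd 5 b)) ∧ ∀ π ∈ dihedralPerms j, π ∈ realisedPerms e := by
  obtain ⟨j, ⟨a, ha⟩, ⟨b, hb⟩⟩ := exists_dihedral_conj g
  refine ⟨j, ⟨⟨a, ha⟩, ⟨b, hb⟩⟩, fun π hπ => ?_⟩
  obtain ⟨t, rfl⟩ := mem_dihedralPerms.1 hπ
  obtain ⟨n, u, hw⟩ := dihPerm_eq_word j a b t
  rw [hw, ← ha, ← hb]
  exact mul_mem_realisedPerms e _ (pow_mem_realisedPerms hrot _) _ (pow_mem_realisedPerms hrefl _)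

end Realised

section Transfer

variable {I : Type} {Kf : I → Type} [∀ i, Field (Kf i)]
  {i₀ i₁ : I} {e : (Kf i₁ →+* ℂ) ≃ Fin 5 × Bool} {τ : Kf i₀ →+* ℂ}
  (hττ : ComplexEmbedding.conjugate τ ≠ τ) (hk : ∀ σ : Kf i₀ →+* ℂ, σ = τ ∨ σ = ComplexEmbedding.conjugate τ)
  {i : Kf i₀ →+* Kf i₁}
  (he_sign : ∀ s : Kf i₁ →+* ℂ, (e s).2 = true ↔ s.comp i = τ)
  (he_conj : ∀ s : Kf i₁ →+* ℂ, e (ComplexEmbedding.conjugate s) = ((e s).1, !(e s).2))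
  {c : Bool} {Φ₃ : ∀ j : Fin 3, CMType (Kf (pairSlots i₀ i₁ j))}
  (hΦ : ∀ (m : Fin 2) (s : Kf i₁ →+* ℂ), s ∈ (Φ₃ m.succ).1 ↔ (e s).2 = inPos c m (e s).1)
  (hΨ : ∀ σ : Kf i₀ →+* ℂ, σ ∈ (Φ₃ 0).1 ↔ σ = τ)
  {N : ℕ} (κ : Fin N → Fin 3)

include hττ hk he_sign he_conj hΦ hΨ in
/-- **FRAME TRANSFER under a realised dihedral group** `D₅(j)` at a clean position (`dihGood c j`): every `Aut(ℂ)`-balanced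
weight of `⨁_j A₃(κ j)` satisfies all sixty `A₅` equations `ModelBalancedD`.
[cite: GaoUllmo2025, Thm 3.1 (3.2)] [cite: Pohlmann1968, Thm 1] -/
theorem modelBalancedD_of_isGaloisBalancedAlg_dihedral [NumberField (Kf i₁)] [IsCMField (Kf i₁)]
    {j : Fin 6} (hgood : dihGood c j = true) (hsub : ∀ π ∈ dihedralPerms j, π ∈ realisedPerms e)
    {S : Finset ((j : Fin N) × (Kf (pairSlots i₀ i₁ (κ j)) →+* ℂ))}
    (hS : IsGaloisBalancedAlg (K := fun j => Kf (pairSlots i₀ i₁ (κ j))) (fun j => Φ₃ (κ j)) S) :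
    ModelBalancedD c (fun x => toPtD e τ ((Sigma.map κ (fun _ => id) :
      ((j : Fin N) × (Kf (pairSlots i₀ i₁ (κ j)) →+* ℂ)) → ((m : Fin 3) × (Kf (pairSlots i₀ i₁ m) →+* ℂ))) x)) S := by
  have hP := modelBalancedP_of_isGaloisBalancedAlg hττ hk he_sign he_conj hΦ hΨ κ hS
  exact modelBalancedD_of_modelBalancedP_dihedral hgood fun π hπ => hP π (hsub π hπ)

end Transfer

section Assembly

variable {I : Type} {Kf : I → Type} [∀ i, Field (Kf i)] [∀ i, NumberField (Kf i)] [∀ i, IsCMField (Kf i)]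
  {i₀ i₁ : I} {τ : Kf i₀ →+* ℂ} {i : Kf i₀ →+* Kf i₁} {c : Bool}
  {A₃ : Fin 3 → AbelianVariety ℂ} {Φ₃ : ∀ j : Fin 3, CMType (Kf (pairSlots i₀ i₁ j))}
  {ι₃ : ∀ j, 𝓞 (Kf (pairSlots i₀ i₁ j)) →+* End (A₃ j)}
  {θ₃ : ∀ j, Kf (pairSlots i₀ i₁ j) →+* Module.End ℂ (complexBetti (A₃ j).X 1)}

/-- **MAIN THEOREM (frame form, realised dihedral group).**  Two `(2,3)`-types at a clean position of a realised dihedral group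
`D₅(j)` (`hgood`, `hsub`; every `j` is clean for meeting types): the Hodge conjecture for every `⨁_j A₃(κ j)`, GIVEN ONLY Markman's
sixfold theorem. [cite: Markman2025SecantWeil, Thm 1.5.1] [cite: Pohlmann1968, Thm 1] -/
theorem hodgeConjectureFor_biproduct_comp_of_frameD_of_markmanSixfold_dihedral
    (hM6 : Markman2025_weilClasses_algebraic_hyperbolicSixfold)
    {N : ℕ} (κ : Fin N → Fin 3) (h10 : Module.finrank ℚ (Kf i₁) = 10) (h2 : Module.finrank ℚ (Kf i₀) = 2) (i : Kf i₀ →+* Kf i₁)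
    {δ : 𝓞 (Kf i₀)} {d : ℕ} (hd : 0 < d) (hδ : ((δ : Kf i₀)) ^ 2 = -(d : Kf i₀))
    (hτ : τ (δ : Kf i₀) = Complex.I * (Real.sqrt d : ℂ))
    (hA : ∀ j, IsCMTypeRealisation (Φ₃ j) (A₃ j) (ι₃ j) (θ₃ j))
    (e : (Kf i₁ →+* ℂ) ≃ Fin 5 × Bool)
    (he_sign : ∀ s : Kf i₁ →+* ℂ, (e s).2 = true ↔ s.comp i = τ)
    (he_conj : ∀ s : Kf i₁ →+* ℂ, e (ComplexEmbedding.conjugate s) = ((e s).1, !(e s).2))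
    (hΦ : ∀ (m : Fin 2) (s : Kf i₁ →+* ℂ), s ∈ (Φ₃ m.succ).1 ↔ (e s).2 = inPos c m (e s).1)
    (hΨ : ∀ σ : Kf i₀ →+* ℂ, σ ∈ (Φ₃ 0).1 ↔ σ = τ)
    {j : Fin 6} (hgood : dihGood c j = true) (hsub : ∀ π ∈ dihedralPerms j, π ∈ realisedPerms e) :
    HodgeConjectureFor (⨁ fun j => A₃ (κ j)).dim (⨁ fun j => A₃ (κ j)).X :=
  hodgeConjectureFor_biproduct_comp_of_frameD_of_markmanSixfold_of_transfer hM6 κ h10 h2 i hd hδ hτ hA e he_sign he_conj hΦ hΨ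
    fun _ hS => modelBalancedD_of_isGaloisBalancedAlg_dihedral (QuarticCM.conjugate_ne τ)
      (fun σ => QuarticCM.eq_or_eq_conjugate_of_quadratic h2 τ σ) he_sign he_conj hΦ hΨ κ hgood hsub hS

end Assembly

/-! ## §2 The intrinsic theorem: meeting types, rotated-and-reflected fibre -/

section Main

variable {K : Type} [Field K] [NumberField K] [IsCMField K] {k : Type} [Field k] [NumberField k] [IsCMField k] {N : ℕ}
  {Φ₁ Φ₂ : CMType K} {B₁ B₂ : AbelianVariety ℂ}
  {ι₁ : 𝓞 K →+* End B₁} {θ₁ : K →+* Module.End ℂ (complexBetti B₁.X 1)}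
  {ι₂ : 𝓞 K →+* End B₂} {θ₂ : K →+* Module.End ℂ (complexBetti B₂.X 1)}
  {Ψ : CMType k} {E : AbelianVariety ℂ} {ιE : 𝓞 k →+* End E} {θE : k →+* Module.End ℂ (complexBetti E.X 1)}

omit [IsCMField K] [NumberField k] [IsCMField k] in
/-- **Meeting types sit at the meeting normal position**: if `Φ₁`, `Φ₂` are read at `inPos c 0`, `inPos c 1` in a frame and
share exactly one embedding over `τ`, then `c = true`. [folklore] -/
theorem normalPos_eq_true_of_meet {e : (K →+* ℂ) ≃ Fin 5 × Bool} {i : k →+* K} {τ : k →+* ℂ} {c : Bool}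
    (he_sign : ∀ s, (e s).2 = true ↔ s.comp i = τ)
    (hr₁ : ∀ s, s ∈ Φ₁.1 ↔ (e s).2 = inPos c 0 (e s).1) (hr₂ : ∀ s, s ∈ Φ₂.1 ↔ (e s).2 = inPos c 1 (e s).1)
    (hmeet : (Finset.univ.filter fun s : K →+* ℂ => s.comp i = τ ∧ (s ∈ Φ₁.1 ∧ s ∈ Φ₂.1)).card = 1) : c = true := by
  have hP : ∀ a : Fin 5, (e.symm (a, true) ∈ Φ₁.1 ∧ e.symm (a, true) ∈ Φ₂.1) ↔
      (inPos c 0 a = true ∧ inPos c 1 a = true) := fun a => by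
    rw [hr₁, hr₂, Equiv.apply_symm_apply]
    exact ⟨fun h => ⟨h.1.symm, h.2.symm⟩, fun h => ⟨h.1.symm, h.2.symm⟩⟩
  have h1 : (Finset.univ.filter fun a : Fin 5 => inPos c 0 a = true ∧ inPos c 1 a = true).card = 1 := by
    have key := card_filter_symm_true₅ he_sign (fun s => s ∈ Φ₁.1 ∧ s ∈ Φ₂.1)
    have key' : (Finset.univ.filter fun a : Fin 5 => e.symm (a, true) ∈ Φ₁.1 ∧ e.symm (a, true) ∈ Φ₂.1).card = 1 := by
      convert hmeet using 1
      convert key using 3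
    calc (Finset.univ.filter fun a : Fin 5 => inPos c 0 a = true ∧ inPos c 1 a = true).card
        = (Finset.univ.filter fun a : Fin 5 => e.symm (a, true) ∈ Φ₁.1 ∧ e.symm (a, true) ∈ Φ₂.1).card := by
          congr 1
          exact Finset.filter_congr fun a _ => (hP a).symm
      _ = 1 := key'
  cases c
  · exact absurd h1 (by decide)
  · rfl

/-- **THE HODGE CONJECTURE FOR EVERY PRODUCT OF COPIES OF `E, B₁, B₂` — two `(2,3)`-fivefolds over a decic `K ⊇ i(k)` whose
types SHARE EXACTLY ONE embedding over `τ`, non-cyclic quintic part — GIVEN ONLY Markman's hyperbolic-sixfold theorem.**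
Hypotheses: `B_l ⊨ (K; Φ_l)` with two members of `Φ_l` over `τ` (`h23ₗ`), exactly one common (`hmeet`); `E ⊨ (k; Ψ ∋ τ)`; and an
enumeration `x` of the five embeddings over `τ` that one automorphism of `ℂ` ROTATES (`x_l ↦ x_{l+1}`) and another REFLECTS
(`x_l ↦ x_{−l}`) (`hD5`: the realised group contains a dihedral group of order `10` — every non-cyclic quintic part `D₅`, `F₂₀`,
`A₅`, `S₅`).  Conclusion: for every `κ : Fin N → Fin 3`, every rational `(q,q)`-class on `⨁_j ![E, B₁, B₂](κ j)` is algebraic.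
[cite: Markman2025SecantWeil, Thm 1.5.1] [cite: Pohlmann1968, Thm 1] [cite: Shimura1998, §18.2 Lemma (i)] [cite: MumfordAV1970, §19] -/
theorem hodgeConjectureFor_biproduct_comp_vec_of_markmanD_dihedral
    (hM6 : Markman2025_weilClasses_algebraic_hyperbolicSixfold)
    (h10 : Module.finrank ℚ K = 10) (h2 : Module.finrank ℚ k = 2) (i : k →+* K)
    (hB₁ : IsCMTypeRealisation Φ₁ B₁ ι₁ θ₁) (hB₂ : IsCMTypeRealisation Φ₂ B₂ ι₂ θ₂) (hE : IsCMTypeRealisation Ψ E ιE θE)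
    {τ : k →+* ℂ} (hτΨ : τ ∈ Ψ.1)
    (h23₁ : (Finset.univ.filter fun s : K →+* ℂ => s.comp i = τ ∧ s ∈ Φ₁.1).card = 2)
    (h23₂ : (Finset.univ.filter fun s : K →+* ℂ => s.comp i = τ ∧ s ∈ Φ₂.1).card = 2)
    (hmeet : (Finset.univ.filter fun s : K →+* ℂ => s.comp i = τ ∧ (s ∈ Φ₁.1 ∧ s ∈ Φ₂.1)).card = 1)
    (hD5 : ∃ (x : Fin 5 ↪ {s : K →+* ℂ // s.comp i = τ}) (ρ ρ' : ℂ ≃+* ℂ),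
      (∀ l : Fin 5, (ρ : ℂ →+* ℂ).comp (x l).1 = (x (l + 1)).1) ∧ (∀ l : Fin 5, (ρ' : ℂ →+* ℂ).comp (x l).1 = (x (-l)).1))
    (κ : Fin N → Fin 3) :
    HodgeConjectureFor (⨁ fun j => (![E, B₁, B₂] : Fin 3 → AbelianVariety ℂ) (κ j)).dim
      (⨁ fun j => (![E, B₁, B₂] : Fin 3 → AbelianVariety ℂ) (κ j)).X := by
  have hττ : ComplexEmbedding.conjugate τ ≠ τ := QuarticCM.conjugate_ne τ
  have hk : ∀ σ : k →+* ℂ, σ = τ ∨ σ = ComplexEmbedding.conjugate τ := fun σ =>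
    QuarticCM.eq_or_eq_conjugate_of_quadratic h2 τ σ
  have hΨ : ∀ σ : k →+* ℂ, σ ∈ Ψ.1 ↔ σ = τ := by
    intro σ
    rcases hk σ with rfl | rfl
    · exact ⟨fun _ => rfl, fun _ => hτΨ⟩
    · exact ⟨fun h => absurd h ((Ψ.2 τ).1 hτΨ), fun h => absurd h hττ⟩
  -- the types are different (they share one, not two, embeddings over `τ`)
  have hne : Φ₁ ≠ Φ₂ := by
    rintro rfl
    have h : (Finset.univ.filter fun s : K →+* ℂ => s.comp i = τ ∧ (s ∈ Φ₁.1 ∧ s ∈ Φ₁.1)) =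
        Finset.univ.filter fun s : K →+* ℂ => s.comp i = τ ∧ s ∈ Φ₁.1 :=
      Finset.filter_congr fun s _ => by rw [and_self_iff]
    rw [h, h23₁] at hmeet
    exact absurd hmeet (by norm_num)
  obtain ⟨δ₀, d, hd, hδ₀⟩ := CyclicSextic.exists_sq_eq_neg_nat_of_isTotallyComplex k h2
  obtain ⟨δ, hδ, hτ⟩ := exists_delta_of_mem h2 hd hδ₀ τ
  -- the frame in normal form; meeting types force `c = true`
  obtain ⟨e, c, he_sign, he_conj, hr₁, hr₂⟩ := exists_frameD h10 h2 i hττ hk Φ₁ Φ₂ h23₁ h23₂ hne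
  have hc : c = true := normalPos_eq_true_of_meet he_sign hr₁ hr₂ hmeet
  subst hc
  -- the realised rotation and reflection, read in the frame (same labelling `g`)
  obtain ⟨x, ρ, ρ', hρ, hρ'⟩ := hD5
  obtain ⟨g, hg, hrot⟩ := conj_mem_realisedPerms_of_enum he_sign x (f := dihPerm 0 1) (ρ := ρ)
    fun l => by rw [dihPerm_zero_one_apply]; exact hρ l
  obtain ⟨g', hg', hrefl⟩ := conj_mem_realisedPerms_of_enum he_sign x (f := dihPerm 0 5) (ρ := ρ')
    fun l => by rw [dihPerm_zero_five_apply]; exact hρ' l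
  have hgg : g' = g := by
    ext l
    have h := (hg' l).trans (hg l).symm
    exact congrArg Fin.val (Prod.mk.inj (e.symm.injective h)).1
  rw [hgg] at hrefl
  obtain ⟨j, -, hsub⟩ := exists_dihedralPerms_subset_realisedPerms hrot hrefl
  -- the family `Kf = (k, K)` and the three slots `(k, K, K)`
  let Kf : Fin 2 → Type := Fin.cons k fun _ : Fin 1 => K
  letI instF : ∀ j, Field (Kf j) := fun j =>
    Fin.cases (motive := fun j => Field (Kf j)) ‹Field k› (fun _ => ‹Field K›) j
  letI instN : ∀ j, NumberField (Kf j) := fun j =>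
    Fin.cases (motive := fun j => NumberField (Kf j)) ‹NumberField k› (fun _ => ‹NumberField K›) j
  haveI instC : ∀ j, IsCMField (Kf j) := fun j =>
    Fin.cases (motive := fun j => IsCMField (Kf j)) ‹IsCMField k› (fun _ => ‹IsCMField K›) j
  exact hodgeConjectureFor_biproduct_comp_of_frameD_of_markmanSixfold_dihedral (Kf := Kf) (i₀ := 0) (i₁ := 1) (c := true)
    (A₃ := ![E, B₁, B₂])
    (Φ₃ := Fin.cons Ψ (Fin.cons Φ₁ (Fin.cons Φ₂ finZeroElim)))
    (ι₃ := Fin.cons ιE (Fin.cons ι₁ (Fin.cons ι₂ finZeroElim)))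
    (θ₃ := Fin.cons θE (Fin.cons θ₁ (Fin.cons θ₂ finZeroElim))) hM6 κ h10 h2 i hd hδ hτ
    (Fin.cases hE (Fin.cases hB₁ (Fin.cases hB₂ fun l => l.elim0))) e he_sign he_conj
    (Fin.cases hr₁ (Fin.cases hr₂ fun l => l.elim0)) hΨ (j := j) rfl hsub

/-- **… and for every abelian variety dominated by such a product.** [cite: Markman2025SecantWeil, Thm 1.5.1] [cite: MumfordAV1970, §19] -/
theorem hodgeConjectureFor_of_avDominatedBy_comp_vec_of_markmanD_dihedral
    (hM6 : Markman2025_weilClasses_algebraic_hyperbolicSixfold)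
    (h10 : Module.finrank ℚ K = 10) (h2 : Module.finrank ℚ k = 2) (i : k →+* K)
    (hB₁ : IsCMTypeRealisation Φ₁ B₁ ι₁ θ₁) (hB₂ : IsCMTypeRealisation Φ₂ B₂ ι₂ θ₂) (hE : IsCMTypeRealisation Ψ E ιE θE)
    {τ : k →+* ℂ} (hτΨ : τ ∈ Ψ.1)
    (h23₁ : (Finset.univ.filter fun s : K →+* ℂ => s.comp i = τ ∧ s ∈ Φ₁.1).card = 2)
    (h23₂ : (Finset.univ.filter fun s : K →+* ℂ => s.comp i = τ ∧ s ∈ Φ₂.1).card = 2)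
    (hmeet : (Finset.univ.filter fun s : K →+* ℂ => s.comp i = τ ∧ (s ∈ Φ₁.1 ∧ s ∈ Φ₂.1)).card = 1)
    (hD5 : ∃ (x : Fin 5 ↪ {s : K →+* ℂ // s.comp i = τ}) (ρ ρ' : ℂ ≃+* ℂ),
      (∀ l : Fin 5, (ρ : ℂ →+* ℂ).comp (x l).1 = (x (l + 1)).1) ∧ (∀ l : Fin 5, (ρ' : ℂ →+* ℂ).comp (x l).1 = (x (-l)).1))
    (κ : Fin N → Fin 3) {C : AbelianVariety ℂ}
    (hC : AVDominatedBy C (⨁ fun j => (![E, B₁, B₂] : Fin 3 → AbelianVariety ℂ) (κ j))) :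
    HodgeConjectureFor C.dim C.X :=
  Domination.hodgeConjectureFor_of_avDominatedBy
    (hodgeConjectureFor_biproduct_comp_vec_of_markmanD_dihedral hM6 h10 h2 i hB₁ hB₂ hE hτΨ h23₁ h23₂ hmeet hD5 κ) hC

variable {n : ℕ} {Φ : Fin n → CMType K} {A : Fin n → AbelianVariety ℂ} {ι : ∀ j, 𝓞 K →+* End (A j)}
  {θ : ∀ j, K →+* Module.End ℂ (complexBetti (A j).X 1)}

/-- **THE FAMILY FORM (dihedral).**  `A_j ⊨ (K; Φ_j)` (`j < n`) CM abelian fivefolds, each `Φ_j` equal to `Φ_{j₁}` or `Φ_{j₂}`,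
two `(2,3)`-types sharing exactly one embedding over `τ`; a rotated-and-reflected enumeration of the fibre (`hD5`);
`E ⊨ (k; Ψ ∋ τ)`: every `C` dominated by `E^a × ⨁_j A_j` satisfies the Hodge conjecture, GIVEN ONLY Markman's sixfold theorem.
[cite: Markman2025SecantWeil, Thm 1.5.1] [cite: Shimura1998, §6.1 Thm. 2 Cor.] [cite: MumfordAV1970, §19] -/
theorem hodgeConjectureFor_of_avDominatedBy_family_of_markmanD_dihedral
    (hM6 : Markman2025_weilClasses_algebraic_hyperbolicSixfold)
    (h10 : Module.finrank ℚ K = 10) (h2 : Module.finrank ℚ k = 2) (i : k →+* K)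
    (hA : ∀ j, IsCMTypeRealisation (Φ j) (A j) (ι j) (θ j)) {τ : k →+* ℂ} (j₁ j₂ : Fin n)
    (h23₁ : (Finset.univ.filter fun s : K →+* ℂ => s.comp i = τ ∧ s ∈ (Φ j₁).1).card = 2)
    (h23₂ : (Finset.univ.filter fun s : K →+* ℂ => s.comp i = τ ∧ s ∈ (Φ j₂).1).card = 2)
    (hmeet : (Finset.univ.filter fun s : K →+* ℂ => s.comp i = τ ∧ (s ∈ (Φ j₁).1 ∧ s ∈ (Φ j₂).1)).card = 1)
    (hpos : ∀ j, Φ j = Φ j₁ ∨ Φ j = Φ j₂)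
    (hD5 : ∃ (x : Fin 5 ↪ {s : K →+* ℂ // s.comp i = τ}) (ρ ρ' : ℂ ≃+* ℂ),
      (∀ l : Fin 5, (ρ : ℂ →+* ℂ).comp (x l).1 = (x (l + 1)).1) ∧ (∀ l : Fin 5, (ρ' : ℂ →+* ℂ).comp (x l).1 = (x (-l)).1))
    (hE : IsCMTypeRealisation Ψ E ιE θE) (hτΨ : τ ∈ Ψ.1) (a : ℕ)
    {C : AbelianVariety ℂ} (hC : AVDominatedBy C ((⨁ fun _ : Fin a => E).prod (⨁ A))) :
    HodgeConjectureFor C.dim C.X := by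
  let Bv : Fin 2 → AbelianVariety ℂ := ![A j₁, A j₂]
  have hdomB : ∀ j, ∃ m : Fin 2, AVDominatedBy (A j) (Bv m) := by
    intro j
    rcases hpos j with h | h
    · exact ⟨0, avDominatedBy_of_cmType_eq h (hA j) (hA j₁)⟩
    · exact ⟨1, avDominatedBy_of_cmType_eq h (hA j) (hA j₂)⟩
  choose m hm using hdomB
  let Y : Fin 3 → AbelianVariety ℂ := ![E, A j₁, A j₂]
  have hYsucc : ∀ m : Fin 2, Y m.succ = Bv m := fun m => rfl
  have h₁ : AVDominatedBy (⨁ fun _ : Fin a => E) (⨁ fun _ : Fin a => Y 0) :=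
    AVDominatedBy.biproduct_map fun _ => AVDominatedBy.refl E
  have h₂ : AVDominatedBy (⨁ A) (⨁ fun j => Y (m j).succ) :=
    AVDominatedBy.biproduct_map fun j => by rw [hYsucc]; exact hm j
  have h₁₂' := avDominatedBy_prod_of_biproduct h₁ h₂
  let κ' : Fin a ⊕ Fin n → Fin 3 := Sum.elim (fun _ => 0) fun j => (m j).succ
  have hfam : sumFam (fun _ : Fin a => Y 0) (fun j => Y (m j).succ) = Y ∘ κ' := funext fun x => by
    cases x <;> rfl
  rw [hfam] at h₁₂'
  have hdom := avDominatedBy_biproduct_reindex finSumFinEquiv.symm h₁₂'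
  exact Domination.hodgeConjectureFor_of_avDominatedBy
    (hodgeConjectureFor_biproduct_comp_vec_of_markmanD_dihedral hM6 h10 h2 i (hA j₁) (hA j₂) hE hτΨ h23₁ h23₂ hmeet hD5
      (κ' ∘ finSumFinEquiv.symm)) (hC.trans hdom)

end Main

end Summit.HodgeConjecture.CorCM.DecicWeil23Pair

end
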